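import Literature.AlgebraicGeometry.HodgeTheory.CrossProductsGenericDivisibility
import Literature.AlgebraicGeometry.HodgeTheory.IntegralCohomologyGradedBasisOfFree
import Summits.HodgeConjecture.HodgeConjecture.Theorems.GenericDivisibilityHodgeClassesGenericallyDivisibleAboveDim

/-!
# Route GenericDivisibility — crux `HodgeClassesGenericallyDivisible` (C1, item stmt-HodgeConjecture-18466):
# the product sector `Y ⊗ W` — C1 for ALL integral classes, granted free cohomology and middle coniveau one on `W`

The common generalisation of the sectors `Y ⊗ ℙⁿ` (`…ProjectiveSpace`) and of the descent for
`Y ⊗ C` (`…TensorCurve`). Let `Y`, `W` be smooth projective over `ℂ` of dimensions `d`, `d'`, and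
expand a class `z ∈ Hᵏ((Y ⊗ W)(ℂ); ℤ)`, `k ≥ d + d'`, along a graded `ℤ`-basis `(vⱼ)` of
`H*(W(ℂ); ℤ)` (integral Künneth; the basis exists as soon as the `Hʲ(W(ℂ); ℤ)`, `j ≤ 2d'`, are free:
`HodgeTheory/IntegralCohomologyGradedBasisOfFree`): `z = Σⱼ pr_Y^* aⱼ ⌣ pr_W^* vⱼ`. The basis
classes of degree `> d'` die generically on `W` and the coefficients `aⱼ ∈ H^{k - deg vⱼ}(Y(ℂ); ℤ)` of
the basis classes of degree `< d'` die generically on `Y` (both by the sharp `AboveDimGenericallyZero`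
= Andreotti–Frankel, `stub_aboveDimGenericallyZero_sharp`); ONLY THE MIDDLE DEGREE `deg vⱼ = d'` of
`W` is left, paired with the middle degree `d` of `Y` when `k = d + d'`. Hence:

* `genericDivisibility_tensor_restrict_eq_zero_of_middleConiveau` — if every class of
  `H^{d'}(W(ℂ); ℤ)` dies on the complex points of a non-empty Zariski open of `W` ("middle integral
  coniveau `≥ 1`": vacuous for `d'` odd with `H^{d'}(W(ℂ); ℤ) = 0` — odd-dimensional quadrics, Fano
  threefolds with `b₃ = 0`, …; true for `ℙⁿ` and for surfaces with `p_g = 0`, all of whose integral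
  degree-`2` classes are `(1,1)` and die by the integral Lefschetz theorem), then EVERY class of
  `Hᵏ((Y ⊗ W)(ℂ); ℤ)`, `k ≥ d + d'`, dies on the complex points of a non-empty Zariski open of `Y ⊗ W`;
* `stub_hodgeClassesGenericallyDivisible_tensor_of_middleConiveau` — the registered sub-goal of the
  item: C1 for `X = Y ⊗ W` (`d + d' = 2p`) and ALL integral classes, granted free integral
  cohomology and middle integral coniveau one on `W` (no Hodge-type hypothesis; `y = 0`).

The crux itself is untouched (open problem); on a product the whole difficulty is thus concentrated
in the Künneth component `H^d(Y) ⊗ H^{d'}(W)` — for two surfaces, `H²(S) ⊗ H²(S')`, the `K3 × K3`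
problem.

References: A. Hatcher, *Algebraic Topology* (2002), Thm. 3.16, Prop. 3.10 [HatcherAT2002];
A. Andreotti, T. Frankel, Ann. of Math. 69 (1959), Thm. 1 [AndreottiFrankel1959]; A. Grothendieck,
Topology 8 (1969), §1 [GrothendieckTopology1969].
-/

set_option linter.dupNamespace false

noncomputable section

namespace Summit.HodgeConjecture.HodgeConjecture.Theorems

open CategoryTheory MonoidalCategory
open Literature.AlgebraicGeometry.Motives Literature.AlgebraicGeometry.HodgeTheory
  Literature.AlgebraicTopology.SingularHomology
open Summit.HodgeConjecture.HodgeConjecture.Theses.GenericDivisibility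

/-- **Generic vanishing on `Y ⊗ W` from middle coniveau one on `W`.** Let `Y`, `W` be smooth
projective over `ℂ` of dimensions `d`, `d'`, with `Hʲ(W(ℂ); ℤ)` free for `j ≤ 2d'` and every class of
`H^{d'}(W(ℂ); ℤ)` dying on the complex points of a non-empty Zariski open of `W`. Then for
`k ≥ d + d'` every `z ∈ Hᵏ((Y ⊗ W)(ℂ); ℤ)` dies on the complex points of a non-empty Zariski open of
`Y ⊗ W` (integral Künneth along a graded basis of `H*(W(ℂ); ℤ)`; Andreotti–Frankel on `W` above the
middle and on `Y` for the coefficients of the classes below the middle; the hypothesis in the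
middle; product descent with `μ = 0`). [cite: HatcherAT2002, §3.2 Thm. 3.16 and §3.1 Prop. 3.10]
[cite: AndreottiFrankel1959, Thm. 1] [cite: GrothendieckTopology1969, §1] -/
theorem genericDivisibility_tensor_restrict_eq_zero_of_middleConiveau {d d' : ℕ} {Y W : SchemeOver ℂ}
    (hY : IsSmoothProjective d Y) (hW : IsSmoothProjective d' W)
    (hfree : ∀ j : ℕ, j ≤ 2 * d' → Module.Free ℤ (singularCohomology ℤ ℤ (ComplexPoints W) j))
    (hmid : ∀ e : singularCohomology ℤ ℤ (ComplexPoints W) d',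
      ∃ T : Set W.left, IsClosed T ∧ T ≠ Set.univ ∧ restrictToCompl ℤ W d' T e = 0)
    {k : ℕ} (hk : d + d' ≤ k) (z : singularCohomology ℤ ℤ (ComplexPoints (Y ⊗ W)) k) :
    ∃ Z : Set (Y ⊗ W).left, IsClosed Z ∧ Z ≠ Set.univ ∧
      singularCohomology.map ℤ ℤ
        (⟨Subtype.val, continuous_subtype_val⟩ :
          C(complexPointsCompl (Y ⊗ W) Z, ComplexPoints (Y ⊗ W))) k z = 0 := by
  obtain ⟨σ, _, v, hv⟩ := exists_gradedBasis_int_complexPoints_of_free hW hfree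
  have hyp : ∀ j : (Σ i : Fin (2 * d' + 1), σ i), ((j.1 : ℕ)) ≤ k →
      (∃ T : Set W.left, IsClosed T ∧ T ≠ Set.univ ∧
        restrictToCompl ℤ W (j.1 : ℕ) T (v j.1 j.2) = 0) ∨
      (∀ x : singularCohomology ℤ ℤ (ComplexPoints Y) (k - (j.1 : ℕ)),
        ∃ S : Set Y.left, IsClosed S ∧ S ≠ Set.univ ∧
          ∃ y : singularCohomology ℤ ℤ (complexPointsCompl Y S) (k - (j.1 : ℕ)),
            restrictToCompl ℤ Y (k - (j.1 : ℕ)) S x = 0 • y) := by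
    rintro ⟨⟨j, hjlt⟩, i⟩ _
    rcases Nat.lt_trichotomy j d' with hj | rfl | hj
    · -- below the middle of `W`: the coefficient on `Y` has degree `k - j > d`
      refine Or.inr fun x ↦ ?_
      have hk' : d < k - ((⟨j, hjlt⟩ : Fin (2 * d' + 1)) : ℕ) := by
        change d < k - j
        omega
      obtain ⟨S, hS, hSne, hx⟩ := stub_aboveDimGenericallyZero_sharp hY hk' x
      exact ⟨S, hS, hSne, 0, by rw [nsmul_zero]; exact hx⟩
    · -- the middle of `W`: the hypothesis
      exact Or.inl (hmid (v ⟨j, hjlt⟩ i))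
    · -- above the middle of `W`: Andreotti–Frankel on `W`
      refine Or.inl ?_
      have h2 : d' < ((⟨j, hjlt⟩ : Fin (2 * d' + 1)) : ℕ) := hj
      exact stub_aboveDimGenericallyZero_sharp hW h2 (v ⟨j, hjlt⟩ i)
  obtain ⟨D, hD, hDne, w, hw⟩ := exists_restrictToCompl_eq_nsmul_of_gradedBasis ℤ hY hW
    (fun j : (Σ i, σ i) ↦ (j.1 : ℕ)) (fun j ↦ v j.1 j.2) hv (k := k) 0 hyp z
  exact ⟨D, hD, hDne, by rw [← zero_nsmul w]; exact hw⟩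

/-- **Registered sub-goal `stub_hodgeClassesGenericallyDivisible_tensor_of_middleConiveau` of the
crux item stmt-HodgeConjecture-18466** — the item's statement for the `2p`-folds `X = Y ⊗ W`
(`dim Y + dim W = 2p`), for ALL integral classes, granted: `Hʲ(W(ℂ); ℤ)` free for `j ≤ 2 dim W`
and every class of the middle cohomology `H^{dim W}(W(ℂ); ℤ)` dies on the complex points of a
non-empty Zariski open of `W`. [cite: HatcherAT2002, §3.2 Thm. 3.16]
[cite: AndreottiFrankel1959, Thm. 1] -/
theorem stub_hodgeClassesGenericallyDivisible_tensor_of_middleConiveau :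
    ∀ ⦃p d d' : ℕ⦄ ⦃Y W : SchemeOver ℂ⦄, 1 ≤ p → d + d' = 2 * p → IsSmoothProjective d Y →
      IsSmoothProjective d' W →
      (∀ j : ℕ, j ≤ 2 * d' → Module.Free ℤ (singularCohomology ℤ ℤ (ComplexPoints W) j)) →
      (∀ e : singularCohomology ℤ ℤ (ComplexPoints W) d', ∃ T : Set W.left,
        IsClosed T ∧ T ≠ Set.univ ∧ singularCohomology.map ℤ ℤ
          (⟨Subtype.val, continuous_subtype_val⟩ : C(complexPointsCompl W T, ComplexPoints W)) d' e = 0) →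
      ∀ z : singularCohomology ℤ ℤ
        (ComplexPoints (CategoryTheory.MonoidalCategoryStruct.tensorObj Y W)) (2 * p),
        ∀ m : ℕ, 1 ≤ m →
          ∃ Z : Set (CategoryTheory.MonoidalCategoryStruct.tensorObj Y W).left,
            IsClosed Z ∧ Z ≠ Set.univ ∧
            ∃ y : singularCohomology ℤ ℤ
              (complexPointsCompl (CategoryTheory.MonoidalCategoryStruct.tensorObj Y W) Z) (2 * p),
              m • y = singularCohomology.map ℤ ℤ
                (⟨Subtype.val, continuous_subtype_val⟩ :
                  C(complexPointsCompl (CategoryTheory.MonoidalCategoryStruct.tensorObj Y W) Z,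
                    ComplexPoints (CategoryTheory.MonoidalCategoryStruct.tensorObj Y W))) (2 * p) z := by
  intro p d d' Y W hp hdd hY hW hfree hmid z m _
  obtain ⟨Z, hZ, hZne, h0⟩ := genericDivisibility_tensor_restrict_eq_zero_of_middleConiveau hY hW hfree
    hmid (k := 2 * p) (by omega) z
  exact ⟨Z, hZ, hZne, 0, by rw [nsmul_zero]; exact h0.symm⟩

end Summit.HodgeConjecture.HodgeConjecture.Theorems

end
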